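import Summits.BirchSwinnertonDyer.Rank1Residual.X2.NonsplitBDPExistsInt
import Summits.BirchSwinnertonDyer.Rank1Residual.X11b.BDPValueRigidityInt
import Summits.BirchSwinnertonDyer.Rank1Residual.X11b.FrameIdealRigidity
import Summits.BirchSwinnertonDyer.Rank1Residual.X11b.IntSeriesValueRigidityOneSided
import Summits.BirchSwinnertonDyer.Rank1Residual.X11b.RouteR1LogOmega
import Summits.BirchSwinnertonDyer.Rank1Residual.X11b.BDPRouteIntSeriesContinuity
import HarnessLib

/-!
# O9 ∩ {non-split} over the WIDE receptacle: the ∀-frame ♭ halves c2♭ / c3♭ DO NOT SEE THE FRAME —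
# they are equivalent to their ∃-frame forms (given Hsieh's frame), and c2♭ follows from a VALUE
# THEOREM IN CONTINUOUS-FUNCTION CURRENCY (cell `bsd-eis`, seat `bsd-eis-k5-c4`; route
# `EisensteinPrimes`, crux 4 `BSDpOnCellC`, line b1: atom c2¬split, RULING L8 (d))

HONEST FRAMING (cell `bsd-eis`): theorems + three hypothesis-shaped `@[conjecture]` predicates (attach
points); nothing booked; X2 stays CONSTRUCTION-SHAPED; no label moves. The ♭ halves of
`X2/NonsplitBDPExistsInt.lean` quantify over EVERY ♭-frame `(Ω_K ≠ 0, ‖Ω_p‖ = 1, Q ∈ 𝓞_{ℂ_p}⟦T⟧)` with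
Castella's interpolation property at the datum, while a producer (Hsieh 2014, cas-split, Keller–Yin,
Castella 2024) delivers ONE frame in its own period normalisation. The X11b cell's RIGIDITY ACROSS
PERIODS (sub-cell multr1-p2 gen 25, x11b3-p3 S27, all IN THE TREE) closes exactly this gap at
anticyclotomic data for odd `p`: two ♭-frames of the same `(ι', 𝔭, κ, γ, f)` with non-zero periods
have the SAME constant term (`X11b.constantCoeff_eq_of_isBDPLFunctionInt_of_isAnticyclotomic`, ♭-V1RIG)
and generate the SAME ideal (`X11b.R1.imcEqIntAt_iff_of_isBDPLFunctionInt`); and a value theorem for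
ANY object carrying Castella's display that is CONTINUOUS AT `𝟙` along the interpolation sequences
transfers to every ♭-frame (`X11b.intSeries_constantCoeff_eq_of_isBDPLFunctionInt_of_continuousValues`,
one-sided ♭-V1RIG). This file transports those three theorems to the X2 ∩ {non-split} Heegner datum:

* §1 attach points (hypothesis-shaped, `@[conjecture]`, same binders as c2♭/c3♭ up to the frame):
  **`NonsplitBDPValueSomeFrameOnTreeInt W p`** (c2∃♭: at every datum SOME ♭-frame `(Ω_K ≠ 0, Ω_p ≠ 0,
  Q)` with the interpolation property AND the value at `𝟙`), **`NonsplitIMCEqSomeFrameOnTreeInt W p`**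
  (c3∃♭: SOME ♭-frame with the interpolation property AND the ideal equality), and
  **`NonsplitBDPValueContinuousDisplayAt W p`** (c2-cont: at every datum SOME non-zero virtual periods
  `(Ω_K, Ω_p)` and `u`, `‖u‖ = 1`, such that Castella's display
  `ι'⁻¹(bdpInterpolationValue p f 𝔭 φ_k n_k Ω_K)·Ω_p^{4 n_k}` tends to `u·((1 − a_p(E)p⁻¹)·log_{ω_E} P)²`
  along EVERY interpolation sequence `(φ_k, n_k, r_k)` with `r_k(γ) → 1` — the currency of a `p`-adic
  `L`-function given as a CONTINUOUS FUNCTION ON CHARACTERS, which is how [cas-split] = Castella JIMJ 17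
  Thms. 2.10–2.11 print the object at a `p`-new form (`p ≥ 5`, `a_p(f)` symbolic, NO image hypothesis;
  bsd-eis LIT-DOSSIER §2d(a)/§2e) modulo the three normalisation readings recorded by b2b-bsdres lit
  g53 (CITED-FACTS S-g53-2: central-character ↦ anticyclotomic twist, BDP13 constants, `ω_f ↦ ω_E`);
  NOT in print at `p = 3 ‖ N`). NOTHING asserted.
* §2 **`nonsplitBDPValueOnTreeInt_of_someFrame`** (c2∃♭ ⟹ c2♭, ♭-V1RIG) and
  **`nonsplitIMCEqOnTreeInt_of_someFrame`** (c3∃♭ ⟹ c3♭, ideal rigidity); the converses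
  **`nonsplitBDPValueSomeFrameOnTreeInt_of_onTreeInt`** / **`nonsplitIMCEqSomeFrameOnTreeInt_of_onTreeInt`**
  given Hsieh 2014 Thm. 1 (a frame EXISTS: `exists_isBDPLFunctionInt_of_hsieh2014_of_classX2`) — so
  on the ¬split road the ∀-frame and ∃-frame typings of BOTH halves AGREE (modulo one PUBLISHED fact);
  the ♭ inputs of skeleton b1 are therefore NOT stronger than "for one frame".
* §4 (append) **`nonsplitBDPValueContinuousDisplayAt_of_someFrame`** (c2∃♭ ⟹ c2-cont: the values of a
  frame at the interpolation points → its constant term, `X11b.intSeries_tendsto_value_of_tendsto_zero`)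
  — with §2–§3 the three typings c2♭ / c2∃♭ / c2-cont of the value half are EQUIVALENT on this road
  (the first arrow modulo Hsieh 2014 Thm. 1).
* §3 **`nonsplitBDPValueOnTreeInt_of_continuousDisplay`** (c2-cont ⟹ c2♭, one-sided ♭-V1RIG applied
  to the arbitrary frame; `c ≠ 0` because `a_p(E) = ±1` and `log_{ω_E} P ≠ 0` for `P` of infinite order,
  `X11b.R1.logOmega_ne_zero`). So at `p ≥ 5` the atom c2¬split of crux 4 is ONE value theorem in
  continuous-function currency away from PUB; at `p = 3` (12 106 of the 12 665 B11 cells) no value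
  theorem is printed and c2♭ / c2∃♭ / c2-cont are the honest residue.

CONDITIONAL on every listed binder; nothing booked; no label change. What this is NOT: not a proof of
c2♭ or c3♭; not a Literature fact (the cas-split reading is NOT filed here — RULING L8 (d): memo first,
`HOME/k5-c4-MEMO-1.md`).

References: [Castella2018] Thms. 3.1–3.2 (arXiv:1704.06608 p. 9); [Castella2018Exceptional] Thms.
2.10–2.11, Prop. 2.7 (arXiv:1507.04260 pp. 13–14); [Castella2018Erratum] Thm. 1.1; [Hsieh2014] Thm. 1;
[BertoliniDarmonPrasanna2013] Thm. 5.9, Thm. 5.13; [CastellaHsieh2018] §3.3; [KellerYin2024] Thm. D (PRE).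
-/

set_option autoImplicit false

noncomputable section

open scoped Classical MatrixGroups ModularForm Topology

open Filter CongruenceSubgroup WeierstrassCurve NumberField IsDedekindDomain Field PowerSeries
  Literature.NumberTheory.EllipticCurves Literature.NumberTheory.EllipticCurves.GreenbergSelmer
  Literature.NumberTheory.EllipticCurves.ModularForms
  Literature.NumberTheory.EllipticCurves.Rank1Residual
  Literature.NumberTheory.EllipticCurves.Rank1Residual.Typed
  Literature.NumberTheory.GaloisRepresentations Literature.NumberTheory.GaloisCohomology
  Literature.NumberTheory.Automorphic
  Summit.BirchSwinnertonDyer.Rank1Residual.X11b.AcSelmer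
  Summit.BirchSwinnertonDyer.Rank1Residual.X11b.Halves
  Summit.BirchSwinnertonDyer.Rank1Residual.X11b

namespace Summit.BirchSwinnertonDyer.Rank1Residual.X2

/-! ### §1 Attach points: the ∃-frame forms and the continuous-function currency -/

section Shapes

variable (W : WeierstrassCurve ℚ) [W.IsElliptic] [W.IsGloballyMinimal] (p : ℕ) [Fact p.Prime]

/-- **c2∃♭ — the BDP value at `𝟙` FOR SOME ♭-frame** at every X2 ∩ {non-split} Heegner datum (binders of
`NonsplitBDPValueOnTreeInt` up to the frame): THERE IS a frame `(Ω_K ≠ 0, Ω_p ≠ 0, Q ∈ 𝓞_{ℂ_p}⟦T⟧)` with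
Castella's interpolation property `X11b.R1.IsBDPLFunctionInt p ι' 𝔭 κ γ f Ω_K Ω_p Q` AND
`Q(𝟙) = u·((1 − a_p(E)·p⁻¹)·log_{ω_E} P)²`, `‖u‖ = 1` (`X11b.R1.BDPValueAtOneIntAt`). The shape a PRODUCER
delivers (one construction, its own periods); equivalent to the ∀-frame c2♭ on this road (§2). PRINT
STATUS: [cas-split] Thm. 2.10–2.11 at `p ≥ 5` in continuous-function currency (see
`NonsplitBDPValueContinuousDisplayAt`); not in print at `p = 3 ‖ N`. A predicate; nothing asserted.
[cite: Castella2018, Thm. 3.1 and Thm. 3.2 (arXiv:1704.06608 p. 9) (shape only; nothing asserted)]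
[cite: Castella2018Exceptional, Thm. 2.11 (arXiv:1507.04260 p. 14) (printed value formula, p ≥ 5, p-new, either sign)] -/
@[conjecture]
def NonsplitBDPValueSomeFrameOnTreeInt : Prop :=
  ∀ (N : ℕ) [NeZero N] (K : Type) [Field K] [NumberField K] (Dt : ModularParametrizationData W N)
    (H : HeegnerDatum N (NumberField.discr K)) (ιK : K →+* ℂ) (P : (W.baseChange K).toAffine.Point),
    CellC W p → ¬ W.HasSplitMultiplicativeReductionAtPrime p → W.conductorNorm ℤ = N →
    IsImaginaryQuadratic K → NumberField.discr K < -4 → SatisfiesHeegnerHypothesis N K →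
    (W.quadraticTwist (NumberField.discr K : ℚ)).entireLFunction 1 ≠ 0 →
    WeierstrassCurve.Affine.Point.map ιK.toRatAlgHom P = heegnerPointComplex Dt H →
    ¬ (p : ℤ) ∣ Dt.c → ¬ IsOfFinAddOrder P →
    ∀ (κ : ZpExtension K p), κ.IsAnticyclotomic →
      ∀ (γ : Field.absoluteGaloisGroup K) [Fact (κ.IsTopGenerator γ)]
        (𝔭 : HeightOneSpectrum (𝓞 K)) (h𝔭 : ((p : ℕ) : 𝓞 K) ∈ 𝔭.asIdeal)
        (he : 𝔭.asIdeal.ramificationIdx (𝓞 ℚ) = 1) (hf : 𝔭.asIdeal.inertiaDeg (𝓞 ℚ) = 1),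
        ∀ (f : CuspForm (CongruenceSubgroup.Gamma0 N) 2), IsNewformOf W f →
          ∀ (ι' : PadicAlgCl p ≃+* ℂ),
            (∀ (w : InfinitePlace K) (k : 𝓞 K),
              k ∈ 𝔭.asIdeal ↔ ‖ι'.symm (w.embedding (k : K))‖ < 1) →
            ∃ (ΩK : ℂ) (Ωp : ℂ_[p]) (Q : PowerSeries 𝓞_ℂ_[p]), ΩK ≠ 0 ∧ Ωp ≠ 0 ∧
              R1.IsBDPLFunctionInt p ι' 𝔭 κ γ f ΩK Ωp Q ∧
              R1.BDPValueAtOneIntAt W p (embAt K p 𝔭 h𝔭 he hf) P Q (W.LFunction p)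

/-- **c3∃♭ — the anticyclotomic IMC FOR SOME ♭-frame** at every X2 ∩ {non-split} Heegner datum: THERE IS
a frame `(Ω_K ≠ 0, Ω_p ≠ 0, Q)` with Castella's interpolation property AND
`Ch_Λ(X_ac^∅(E[p^∞]))·𝓞_{ℂ_p}⟦T⟧ = (Q)` (`X11b.R1.IMCEqIntAt`). The shape a PRODUCER delivers; equivalent
to the ∀-frame c3♭ on this road (§2). PRINT STATUS: Keller–Yin Thm. D = v2 Thm. 5.1.3 SHAPE, PREPRINT
with the L1754 gap (the text proves D′; cgshw MEMO-5/6/8). NEVER a theorem in this cell.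
[claim: KellerYin2024, status: under-review] -/
@[conjecture]
def NonsplitIMCEqSomeFrameOnTreeInt : Prop :=
  ∀ (N : ℕ) [NeZero N] (K : Type) [Field K] [NumberField K] (Dt : ModularParametrizationData W N)
    (H : HeegnerDatum N (NumberField.discr K)) (ιK : K →+* ℂ) (P : (W.baseChange K).toAffine.Point),
    CellC W p → ¬ W.HasSplitMultiplicativeReductionAtPrime p → W.conductorNorm ℤ = N →
    IsImaginaryQuadratic K → NumberField.discr K < -4 → SatisfiesHeegnerHypothesis N K →
    (W.quadraticTwist (NumberField.discr K : ℚ)).entireLFunction 1 ≠ 0 →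
    WeierstrassCurve.Affine.Point.map ιK.toRatAlgHom P = heegnerPointComplex Dt H →
    ¬ (p : ℤ) ∣ Dt.c → ¬ IsOfFinAddOrder P →
    ∀ (κ : ZpExtension K p), κ.IsAnticyclotomic →
      ∀ (γ : Field.absoluteGaloisGroup K) [Fact (κ.IsTopGenerator γ)]
        (𝔭 : HeightOneSpectrum (𝓞 K)), ((p : ℕ) : 𝓞 K) ∈ 𝔭.asIdeal →
        𝔭.asIdeal.ramificationIdx (𝓞 ℚ) = 1 → 𝔭.asIdeal.inertiaDeg (𝓞 ℚ) = 1 →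
        ∀ (f : CuspForm (CongruenceSubgroup.Gamma0 N) 2), IsNewformOf W f →
          ∀ (ι' : PadicAlgCl p ≃+* ℂ),
            (∀ (w : InfinitePlace K) (k : 𝓞 K),
              k ∈ 𝔭.asIdeal ↔ ‖ι'.symm (w.embedding (k : K))‖ < 1) →
            ∃ (ΩK : ℂ) (Ωp : ℂ_[p]) (Q : PowerSeries 𝓞_ℂ_[p]), ΩK ≠ 0 ∧ Ωp ≠ 0 ∧
              R1.IsBDPLFunctionInt p ι' 𝔭 κ γ f ΩK Ωp Q ∧ R1.IMCEqIntAt W p κ 𝔭 γ Q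

/-- **c2-cont — the BDP value at `𝟙` in CONTINUOUS-FUNCTION CURRENCY** at every X2 ∩ {non-split} Heegner
datum: there are non-zero VIRTUAL PERIODS `(Ω_K, Ω_p)` and `u ∈ ℂ_p` with `‖u‖ = 1` such that Castella's
display `ι'⁻¹(bdpInterpolationValue p f 𝔭 φ_k n_k Ω_K)·Ω_p^{4 n_k}` tends to
`u·((1 − a_p(E)·p⁻¹)·log_{ω_E} P)²` along EVERY interpolation sequence `(φ_k, n_k, r_k)` (`φ_k` unramified
of infinity type `(n_k, −n_k)`, `n_k > 0`, avatar `r_k` through `κ`) with `r_k(γ) → 1` — i.e. "a `p`-adic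
`L`-function that is a CONTINUOUS function on anticyclotomic characters, carries Castella's
interpolation display in the normalisation `(Ω_K, Ω_p)`, and takes the BDP value at `𝟙`". This is the
hypothesis `hC` of the X11b record `P2.bdpValueSomeFrameOnTree_of_hsieh2014_of_continuousDisplay`
(multr1-p2 gen 25) transported to the X2 ∩ {non-split} datum. INTENDED SOURCE at `p ≥ 5`: [cas-split]
Thm. 2.10 (`L_𝔭(f)` extends continuously to `Σ̂` with the squared interpolation) + Thm. 2.11 / Prop. 2.7
(the value at `𝐍_K` as an `ω_f`-Coleman integral of the Heegner divisor) + display (3.2) of Cas18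
(`π^*ω_E = c·ω_f`, the binder `p ∤ Dt.c`), `a_p(f)` symbolic, `p ≥ 5`, NO image hypothesis — MODULO
three normalisation readings NOT certified from print (b2b-bsdres CITED-FACTS S-g53-2:
`cassplit-central-char-to-anticyclotomic-twist`, `cassplit-BDP13-constants`,
`cassplit-ωf-to-ωE-parametrisation`); NOT in print at `p = 3 ‖ N`. A predicate; TYPED, not asserted.
[cite: Castella2018Exceptional, Thm. 2.10 and Thm. 2.11 (arXiv:1507.04260 pp. 13–14) (shape of the intended source; nothing asserted)]
[cite: Castella2018, Thm. 3.1 and Thm. 3.2 with (3.2) (arXiv:1704.06608 p. 9) (the display's normalisation)] -/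
@[conjecture]
def NonsplitBDPValueContinuousDisplayAt : Prop :=
  ∀ (N : ℕ) [NeZero N] (K : Type) [Field K] [NumberField K] (Dt : ModularParametrizationData W N)
    (H : HeegnerDatum N (NumberField.discr K)) (ιK : K →+* ℂ) (P : (W.baseChange K).toAffine.Point),
    CellC W p → ¬ W.HasSplitMultiplicativeReductionAtPrime p → W.conductorNorm ℤ = N →
    IsImaginaryQuadratic K → NumberField.discr K < -4 → SatisfiesHeegnerHypothesis N K →
    (W.quadraticTwist (NumberField.discr K : ℚ)).entireLFunction 1 ≠ 0 →
    WeierstrassCurve.Affine.Point.map ιK.toRatAlgHom P = heegnerPointComplex Dt H →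
    ¬ (p : ℤ) ∣ Dt.c → ¬ IsOfFinAddOrder P →
    ∀ (κ : ZpExtension K p), κ.IsAnticyclotomic →
      ∀ (γ : Field.absoluteGaloisGroup K) [Fact (κ.IsTopGenerator γ)]
        (𝔭 : HeightOneSpectrum (𝓞 K)) (h𝔭 : ((p : ℕ) : 𝓞 K) ∈ 𝔭.asIdeal)
        (he : 𝔭.asIdeal.ramificationIdx (𝓞 ℚ) = 1) (hf : 𝔭.asIdeal.inertiaDeg (𝓞 ℚ) = 1),
        ∀ (f : CuspForm (CongruenceSubgroup.Gamma0 N) 2), IsNewformOf W f →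
          ∀ (ι' : PadicAlgCl p ≃+* ℂ),
            (∀ (w : InfinitePlace K) (k : 𝓞 K),
              k ∈ 𝔭.asIdeal ↔ ‖ι'.symm (w.embedding (k : K))‖ < 1) →
            ∃ (ΩK : ℂ) (Ωp u : ℂ_[p]), ΩK ≠ 0 ∧ Ωp ≠ 0 ∧ ‖u‖ = 1 ∧
              ∀ (φ : ℕ → HeckeCharacter K) (n : ℕ → ℕ) (r : ℕ → FramedGaloisRep K (PadicAlgCl p) 1),
                (∀ k, 0 < n k) → (∀ k (v : HeightOneSpectrum (𝓞 K)), (φ k).IsUnramifiedAt v) →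
                (∀ k, (φ k).HasInfinityType (fun _ ↦ (n k : ℤ)) (fun _ ↦ -(n k : ℤ))) →
                (∀ k, IsPAdicAvatarOf ι' (φ k) (r k)) → (∀ k, FactorsThroughZp κ (r k)) →
                Tendsto (fun k ↦ avatarValueAt (r k) γ) atTop (𝓝 1) →
                Tendsto (fun k ↦ ((ι'.symm (bdpInterpolationValue p f 𝔭 (φ k) (n k) ΩK) :
                  PadicAlgCl p) : ℂ_[p]) * Ωp ^ (4 * n k)) atTop
                  (𝓝 (u * (algebraMap ℚ_[p] ℂ_[p] (((1 : ℚ_[p]) - ((W.LFunction p : ℤ) : ℚ_[p]) *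
                    (p : ℚ_[p])⁻¹) * logOmega W p (embAt K p 𝔭 h𝔭 he hf) P)) ^ 2))

end Shapes

/-! ### §2 ∃-frame ⟺ ∀-frame on the ¬split road (rigidity across periods; Hsieh for the converse) -/

section SomeAll

variable {W : WeierstrassCurve ℚ} [W.IsElliptic] [W.IsGloballyMinimal] {p : ℕ} [Fact p.Prime]

/-- **c2∃♭ ⟹ c2♭: the value at `𝟙` does not see the frame.** If at every X2 ∩ {non-split} datum SOME
♭-frame carries the BDP value, then EVERY ♭-frame there does: two ♭-frames of the same
`(ι', 𝔭, κ, γ, f)` have the same constant term (`X11b.constantCoeff_eq_of_isBDPLFunctionInt_of_isAnticyclotomic`,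
♭-V1RIG; `p ≠ 2` from `ClassX2`, `K` imaginary quadratic, `κ` anticyclotomic, `γ` a generator).
[cite: Castella2018, Thm. 3.1–3.2 (arXiv:1704.06608 p. 9)] [cite: CastellaHsieh2018, §3.3] -/
theorem nonsplitBDPValueOnTreeInt_of_someFrame (h : NonsplitBDPValueSomeFrameOnTreeInt W p) :
    NonsplitBDPValueOnTreeInt W p := by
  intro N _ K _ _ Dt H ιK P hc hns hN hK hd4 hHN hLt hP hcM hPinf κ hκ γ hγ 𝔭 h𝔭 he hf f hfW ι' hι'
    ΩK Ωp Q hΩK hΩp hQ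
  obtain ⟨ΩK', Ωp', Q', hΩK', hΩp', hQ', u, hu, hval⟩ :=
    h N K Dt H ιK P hc hns hN hK hd4 hHN hLt hP hcM hPinf κ hκ γ 𝔭 h𝔭 he hf f hfW ι' hι'
  have hΩp0 : Ωp ≠ 0 := fun h0 ↦ by rw [h0, norm_zero] at hΩp; exact zero_ne_one hΩp
  have heq : constantCoeff Q = constantCoeff Q' :=
    X11b.constantCoeff_eq_of_isBDPLFunctionInt_of_isAnticyclotomic hc.2.1 hK hκ hγ.out hΩK' hΩK hΩp'
      hΩp0 hQ' hQ
  refine ⟨u, hu, ?_⟩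
  have hv : u * (algebraMap ℚ_[p] ℂ_[p] (((1 : ℚ_[p]) - ((W.LFunction p : ℤ) : ℚ_[p]) *
      (p : ℚ_[p])⁻¹) * logOmega W p (embAt K p 𝔭 h𝔭 he hf) P)) ^ 2 =
      ((constantCoeff Q : 𝓞_ℂ_[p]) : ℂ_[p]) := by
    rw [heq]
    exact hval.unique (X11b.R1.intSeries_hasValueAt_zero p Q')
  rw [hv]
  exact X11b.R1.intSeries_hasValueAt_zero p Q

omit [W.IsElliptic] [W.IsGloballyMinimal] in
/-- **c3∃♭ ⟹ c3♭: the main-conjecture equality does not see the frame.** If at every X2 ∩ {non-split}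
datum SOME ♭-frame satisfies `Ch_Λ(X_ac^∅)·𝓞_{ℂ_p}⟦T⟧ = (Q)`, then EVERY ♭-frame there does: two
♭-frames of the same `(ι', 𝔭, κ, γ, f)` generate the same ideal
(`X11b.R1.imcEqIntAt_iff_of_isBDPLFunctionInt`, ideal rigidity across periods).
[claim: KellerYin2024, status: under-review] [cite: Castella2018, Thm. 3.1 (arXiv:1704.06608 p. 9)] -/
theorem nonsplitIMCEqOnTreeInt_of_someFrame [W.IsElliptic] [W.IsGloballyMinimal]
    (h : NonsplitIMCEqSomeFrameOnTreeInt W p) : NonsplitIMCEqOnTreeInt W p := by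
  intro N _ K _ _ Dt H ιK P hc hns hN hK hd4 hHN hLt hP hcM hPinf κ hκ γ hγ 𝔭 h𝔭 he hf f hfW ι' hι'
    ΩK Ωp Q hΩK hΩp hQ
  obtain ⟨ΩK', Ωp', Q', hΩK', hΩp', hQ', himc⟩ :=
    h N K Dt H ιK P hc hns hN hK hd4 hHN hLt hP hcM hPinf κ hκ γ 𝔭 h𝔭 he hf f hfW ι' hι'
  have hΩp0 : Ωp ≠ 0 := fun h0 ↦ by rw [h0, norm_zero] at hΩp; exact zero_ne_one hΩp
  exact (X11b.R1.imcEqIntAt_iff_of_isBDPLFunctionInt (W := W) hc.2.1 hK hκ hΩK' hΩK hΩp' hΩp0 hQ'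
    hQ).mp himc

/-- **c2♭ ⟹ c2∃♭, given Hsieh 2014 Thm. 1** (a ♭-frame EXISTS at every X2 datum:
`exists_isBDPLFunctionInt_of_hsieh2014_of_classX2`, with `X11b.lambdaSupplyAt`). So on the ¬split road
the ∀-frame and ∃-frame typings of the value half agree modulo one PUBLISHED fact.
[cite: Hsieh2014, Thm. 1 (arXiv:1112.1580 pp. 3–4)] [cite: Castella2018, Thm. 3.2 (arXiv:1704.06608 p. 9)] -/
theorem nonsplitBDPValueSomeFrameOnTreeInt_of_onTreeInt
    (hH : hsieh2014_exists_anticyclotomicPAdicLFunction) (h : NonsplitBDPValueOnTreeInt W p) :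
    NonsplitBDPValueSomeFrameOnTreeInt W p := by
  intro N _ K _ _ Dt H ιK P hc hns hN hK hd4 hHN hLt hP hcM hPinf κ hκ γ hγ 𝔭 h𝔭 he hf f hfW ι' hι'
  obtain ⟨ΩK, Ωp, Q, hΩK, hΩp, hQ⟩ := exists_isBDPLFunctionInt_of_hsieh2014_of_classX2 W p hH ι' 𝔭 κ
    γ hfW hc.2 hN hK hHN h𝔭 hι' hκ hγ.out
  have hΩp0 : Ωp ≠ 0 := fun h0 ↦ by rw [h0, norm_zero] at hΩp; exact zero_ne_one hΩp
  exact ⟨ΩK, Ωp, Q, hΩK, hΩp0, hQ, h N K Dt H ιK P hc hns hN hK hd4 hHN hLt hP hcM hPinf κ hκ γ 𝔭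
    h𝔭 he hf f hfW ι' hι' ΩK Ωp Q hΩK hΩp hQ⟩

omit [W.IsGloballyMinimal] in
/-- **c3♭ ⟹ c3∃♭, given Hsieh 2014 Thm. 1** (a ♭-frame exists at every X2 datum). So on the ¬split road
the ∀-frame and ∃-frame typings of the main-conjecture half agree modulo one PUBLISHED fact.
[cite: Hsieh2014, Thm. 1 (arXiv:1112.1580 pp. 3–4)] [claim: KellerYin2024, status: under-review] -/
theorem nonsplitIMCEqSomeFrameOnTreeInt_of_onTreeInt
    (hH : hsieh2014_exists_anticyclotomicPAdicLFunction) (h : NonsplitIMCEqOnTreeInt W p) :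
    NonsplitIMCEqSomeFrameOnTreeInt W p := by
  intro N _ K _ _ Dt H ιK P hc hns hN hK hd4 hHN hLt hP hcM hPinf κ hκ γ hγ 𝔭 h𝔭 he hf f hfW ι' hι'
  obtain ⟨ΩK, Ωp, Q, hΩK, hΩp, hQ⟩ := exists_isBDPLFunctionInt_of_hsieh2014_of_classX2 W p hH ι' 𝔭 κ
    γ hfW hc.2 hN hK hHN h𝔭 hι' hκ hγ.out
  have hΩp0 : Ωp ≠ 0 := fun h0 ↦ by rw [h0, norm_zero] at hΩp; exact zero_ne_one hΩp
  exact ⟨ΩK, Ωp, Q, hΩK, hΩp0, hQ, h N K Dt H ιK P hc hns hN hK hd4 hHN hLt hP hcM hPinf κ hκ γ 𝔭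
    h𝔭 he hf f hfW ι' hι' ΩK Ωp Q hΩK hΩp hQ⟩

end SomeAll

/-! ### §3 c2♭ from a value theorem in continuous-function currency (one-sided ♭-V1RIG) -/

section Continuity

variable {W : WeierstrassCurve ℚ} [W.IsElliptic] [W.IsGloballyMinimal] {p : ℕ} [Fact p.Prime]

/-- `(1 − a·p⁻¹)·x ≠ 0` in `ℂ_p` for `p ∤ a` and `x ≠ 0` (`‖1 − a·p⁻¹‖ = p`, `X11b.R1.norm_one_sub_div_eq`).
[folklore] -/
theorem algebraMap_one_sub_div_mul_ne_zero {a : ℤ} (ha : ¬ (p : ℤ) ∣ a) {x : ℚ_[p]} (hx : x ≠ 0) :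
    algebraMap ℚ_[p] ℂ_[p] (((1 : ℚ_[p]) - (a : ℚ_[p]) * (p : ℚ_[p])⁻¹) * x) ≠ 0 := by
  rw [map_ne_zero_iff _ (algebraMap ℚ_[p] ℂ_[p]).injective]
  refine mul_ne_zero ?_ hx
  intro h0
  have h := X11b.R1.norm_one_sub_div_eq p ha
  rw [h0, norm_zero] at h
  have hp : (0 : ℝ) < p := by exact_mod_cast (Fact.out : p.Prime).pos
  exact absurd h (ne_of_lt hp)

/-- **c2-cont ⟹ c2♭: a value theorem in CONTINUOUS-FUNCTION currency transfers to EVERY ♭-frame.** At an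
X2 ∩ {non-split} datum let `(Ω_K, Ω_p, Q)` be any ♭-frame; the display's virtual periods `(Ω_K⁰, Ω_p⁰)`
and unit `u` give convergence of Castella's display to `c = u·((1 − a_p(E)p⁻¹)·log_{ω_E} P)²` along
every interpolation sequence with `r_k(γ) → 1`; `c ≠ 0` (`a_p(E) = ±1` at multiplicative `p`,
`X11b.R1.not_dvd_lFunction_of_mult`; `log_{ω_E} P ≠ 0` for `P` of infinite order,
`X11b.R1.logOmega_ne_zero`); so `[T⁰]Q = c` by one-sided ♭-V1RIG
(`X11b.intSeries_constantCoeff_eq_of_isBDPLFunctionInt_of_continuousValues`: the character supply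
accumulating at `𝟙` is a THEOREM at odd `p`, `X11b.exists_interpolationSupply_pow`), and `Q(𝟙) = [T⁰]Q`.
Hence c2♭ `NonsplitBDPValueOnTreeInt W p`. CONDITIONAL on c2-cont (typed, intended source [cas-split]
Thms. 2.10–2.11 at `p ≥ 5` modulo three readings; not in print at `p = 3`); nothing booked.
[cite: Castella2018Exceptional, Thm. 2.10 and Thm. 2.11 (arXiv:1507.04260 pp. 13–14)]
[cite: Castella2018, Thm. 3.1–3.2 (arXiv:1704.06608 p. 9)] [cite: SilvermanAEC2009, IV.6.4 and VII.6.3] -/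
theorem nonsplitBDPValueOnTreeInt_of_continuousDisplay
    (h : NonsplitBDPValueContinuousDisplayAt W p) : NonsplitBDPValueOnTreeInt W p := by
  intro N _ K _ _ Dt H ιK P hc hns hN hK hd4 hHN hLt hP hcM hPinf κ hκ γ hγ 𝔭 h𝔭 he hf f hfW ι' hι'
    ΩK Ωp Q hΩK hΩp hQ
  obtain ⟨ΩK₀, Ωp₀, u, hΩK₀, hΩp₀, hu, hcont⟩ :=
    h N K Dt H ιK P hc hns hN hK hd4 hHN hLt hP hcM hPinf κ hκ γ 𝔭 h𝔭 he hf f hfW ι' hι'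
  have hΩp0 : Ωp ≠ 0 := fun h0 ↦ by rw [h0, norm_zero] at hΩp; exact zero_ne_one hΩp
  -- `c ≠ 0`
  have ha : ¬ (p : ℤ) ∣ W.LFunction p := X11b.R1.not_dvd_lFunction_of_mult hfW hc.2.2.2
  have hX : algebraMap ℚ_[p] ℂ_[p] (((1 : ℚ_[p]) - ((W.LFunction p : ℤ) : ℚ_[p]) * (p : ℚ_[p])⁻¹) *
      logOmega W p (embAt K p 𝔭 h𝔭 he hf) P) ≠ 0 :=
    algebraMap_one_sub_div_mul_ne_zero ha (X11b.R1.logOmega_ne_zero W p _ hPinf)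
  have hu0 : u ≠ 0 := fun h0 ↦ by rw [h0, norm_zero] at hu; exact zero_ne_one hu
  have hc0 : u * (algebraMap ℚ_[p] ℂ_[p] (((1 : ℚ_[p]) - ((W.LFunction p : ℤ) : ℚ_[p]) *
      (p : ℚ_[p])⁻¹) * logOmega W p (embAt K p 𝔭 h𝔭 he hf) P)) ^ 2 ≠ 0 :=
    mul_ne_zero hu0 (pow_ne_zero _ hX)
  have heq := X11b.intSeries_constantCoeff_eq_of_isBDPLFunctionInt_of_continuousValues hc.2.1 hK hκ
    hγ.out hΩK₀ hΩK hΩp₀ hΩp0 hcont hc0 hQ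
  refine ⟨u, hu, ?_⟩
  rw [← heq]
  exact X11b.R1.intSeries_hasValueAt_zero p Q

end Continuity

/-! ### §4 (append) c2∃♭ ⟹ c2-cont: a frame with the value IS a continuous display -/

section FrameToContinuity

variable {W : WeierstrassCurve ℚ} [W.IsElliptic] [W.IsGloballyMinimal] {p : ℕ} [Fact p.Prime]

/-- **c2∃♭ ⟹ c2-cont: the continuous-function currency is NOT weaker than the frame currency.** If at a
datum SOME ♭-frame `(Ω_K, Ω_p, Q)` carries the BDP value `c = u·((1 − a_p p⁻¹)·log_{ω_E} P)²` at `𝟙`,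
then with the virtual periods `(Ω_K, Ω_p)` themselves Castella's display along ANY interpolation sequence
with `r_k(γ) → 1` is the sequence of VALUES of `Q` at the points `r_k(γ) − 1 → 0`, which tends to
`[T⁰]Q = c` (`X11b.intSeries_tendsto_value_of_tendsto_zero`: `‖Q(x) − Q(0)‖ ≤ ‖x‖`). With §2–§3 this
closes the circle c2♭ ⟹ c2∃♭ ⟹ c2-cont ⟹ c2♭ (the first arrow modulo Hsieh 2014 Thm. 1): the three
typings of the value half are EQUIVALENT on the ¬split road, so a source may be read in whichever
currency it is printed in. [cite: Castella2018, Thm. 3.1–3.2 (arXiv:1704.06608 p. 9)]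
[cite: Hsieh2014, Thm. 1 and p. 7 (arXiv:1112.1580)] -/
theorem nonsplitBDPValueContinuousDisplayAt_of_someFrame (h : NonsplitBDPValueSomeFrameOnTreeInt W p) :
    NonsplitBDPValueContinuousDisplayAt W p := by
  intro N _ K _ _ Dt H ιK P hc hns hN hK hd4 hHN hLt hP hcM hPinf κ hκ γ hγ 𝔭 h𝔭 he hf f hfW ι' hι'
  obtain ⟨ΩK, Ωp, Q, hΩK, hΩp, hQ, u, hu, hval⟩ :=
    h N K Dt H ιK P hc hns hN hK hd4 hHN hLt hP hcM hPinf κ hκ γ 𝔭 h𝔭 he hf f hfW ι' hι'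
  refine ⟨ΩK, Ωp, u, hΩK, hΩp, hu, ?_⟩
  intro φ n r hn hunr hinf hr hrκ hlim
  have hx : Tendsto (fun k ↦ avatarValueAt (r k) γ - 1) atTop (𝓝 0) := by
    have h1 := hlim.sub_const 1
    rwa [sub_self] at h1
  have hvals : ∀ k, IntSeries.HasValueAt Q (avatarValueAt (r k) γ - 1)
      (((ι'.symm (bdpInterpolationValue p f 𝔭 (φ k) (n k) ΩK) : PadicAlgCl p) : ℂ_[p]) *
        Ωp ^ (4 * n k)) :=
    fun k ↦ hQ (φ k) (n k) (hn k) (hunr k) (hinf k) (r k) (hr k) (hrκ k)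
  have hc : u * (algebraMap ℚ_[p] ℂ_[p] (((1 : ℚ_[p]) - ((W.LFunction p : ℤ) : ℚ_[p]) *
      (p : ℚ_[p])⁻¹) * logOmega W p (embAt K p 𝔭 h𝔭 he hf) P)) ^ 2 =
      ((constantCoeff Q : 𝓞_ℂ_[p]) : ℂ_[p]) :=
    hval.unique (X11b.R1.intSeries_hasValueAt_zero p Q)
  rw [hc]
  exact X11b.intSeries_tendsto_value_of_tendsto_zero hx hvals

end FrameToContinuity

end Summit.BirchSwinnertonDyer.Rank1Residual.X2

end
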